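import Mathlib.Analysis.Convex.PathConnected
import Literature.Probability.LatticeModels.LatticeLoopWinding
import Literature.Topology.PlaneTopology.ArgumentIncrement
import Literature.Topology.PlaneTopology.ChartParity
import HarnessLib

/-!
# A closed lattice walk in a simply connected plane set encloses only faces of that set

Topic `Literature/Probability/LatticeModels`; the topological half of the proof of Kasteleyn's
theorem for simply connected regions of `ℤ²` (named fact `Kenyon1997_prop5` of
`KasteleynMatrix.lean`, discharged in `KasteleynMatrixProofs.lean`), bridging the combinatorial
winding number `ClosedWalk.W` of `LatticeLoopWinding.lean` and the winding number `wind` of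
continuous loops of `Literature/Topology/PlaneTopology/WindingNumber.lean`:

* `ClosedWalk.loop c` — the closed polygon in `ℂ` through the vertices of the walk (a `Path`,
  concatenation of the unit segments `Path.segment`);
* `ClosedWalk.wind_loop_sub_ctr` — **its winding number about the centre of the face `f` is
  `W c f`**: both vanish far to the left and jump by the net number of traversals of the
  vertical edge between two horizontally adjacent faces (`W_succ_fst`; for `wind` this is the
  crossing count `Path.crossInc` of `ArgumentIncrement.lean`, `±2πi` per transversal crossing of
  the segment joining the two centres, which a unit lattice segment crosses iff it is that edge);
* `ClosedWalk.W_eq_zero_of_ctr_notMem` — **if the walk runs inside a simply connected set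
  `K ⊆ ℂ` (every step segment lies in `K`), then `W c f = 0` for every face whose centre is not in
  `K`**: the polygon is null-homotopic in `K ⊆ ℂ \ {centre}` (Mathlib's
  `isSimplyConnected_iff_exists_homotopy_refl_forall_mem`), and the winding number is a homotopy
  invariant (`wind_eq_zero_of_homotopy_const` of `ChartParity.lean`).

In the application `K` is a union of closed lattice faces and the conclusion reads: every face
with non-zero winding number belongs to the union ("a simply connected union of squares has no
holes"). Everything is proved. [folklore]

## Overlap (deliberately not imported)

`toC : ℤ × ℤ → ℂ` with `toC_re`/`toC_im` also exists as `…RandomPlanarGeometry.SAW.YangBaxter.toC`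
(`YangBaxterSAWBoundaryWinding.lean`, self-avoiding-walk cone) and the three-line
`Path.crossInc_cast` as `…LatticeModels.Path.crossInc_cast` (`MedialCycleSeparation.lean`, FK-Ising
s-holomorphicity cone); both modules carry large unrelated import closures, so the embedding is
restated here (one definition) and the cast lemma is a `private` helper.

## References

* L. V. Ahlfors, *Complex Analysis*, 3rd ed. (1979), §4.2.1 (winding numbers, constancy on
  complementary components, jump across an arc). [cite: Ahlfors1979, §4.2.1]
* R. Kenyon, *Local statistics of lattice dimers*, AIHP 33 (1997), §2.1 ("simply connected
  subgraph = 1-skeleton of a simply connected union of basic squares"). [Kenyon1997]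
-/

noncomputable section

namespace Literature.Probability.LatticeModels

open Set Finset Complex Literature.Topology.PlaneTopology
open scoped Real

/-! ### Lattice points and face centres in `ℂ` -/

/-- The lattice point `p ∈ ℤ²` as a complex number. [folklore] -/
def toC (p : ℤ × ℤ) : ℂ := ⟨p.1, p.2⟩

/-- The centre `(p + ½) + (q + ½) i` of the unit face `f = (p, q)`. [folklore] -/
def ctr (f : ℤ × ℤ) : ℂ := ⟨f.1 + 1 / 2, f.2 + 1 / 2⟩

/-- Real part of a lattice point. [folklore] -/
@[simp] theorem toC_re (p : ℤ × ℤ) : (toC p).re = p.1 := rfl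

/-- Imaginary part of a lattice point. [folklore] -/
@[simp] theorem toC_im (p : ℤ × ℤ) : (toC p).im = p.2 := rfl

/-- Real part of a face centre. [folklore] -/
@[simp] theorem ctr_re (f : ℤ × ℤ) : (ctr f).re = f.1 + 1 / 2 := rfl

/-- Imaginary part of a face centre. [folklore] -/
@[simp] theorem ctr_im (f : ℤ × ℤ) : (ctr f).im = f.2 + 1 / 2 := rfl

/-- A real number that is an integer plus one half is not an integer. [folklore] -/
theorem int_add_half_ne_int (a b : ℤ) : (a : ℝ) + 1 / 2 ≠ b := by
  intro h
  have h2 : (2 * a + 1 : ℝ) = 2 * b := by linarith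
  have h3 : (2 * a + 1 : ℤ) = 2 * b := by exact_mod_cast h2
  omega

/-- A point of the unit segment between lattice neighbours has an integer coordinate equal to
the common coordinate of the endpoints, the other coordinate lying between theirs. [folklore] -/
theorem segment_toC_subset {P Q : ℤ × ℤ} (h : RectLoop.Adj P Q) {z : ℂ}
    (hz : z ∈ segment ℝ (toC P) (toC Q)) :
    (z.im = P.2 ∧ z.im = Q.2 ∧ min (P.1 : ℝ) Q.1 ≤ z.re ∧ z.re ≤ max (P.1 : ℝ) Q.1) ∨
    (z.re = P.1 ∧ z.re = Q.1 ∧ min (P.2 : ℝ) Q.2 ≤ z.im ∧ z.im ≤ max (P.2 : ℝ) Q.2) := by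
  rw [segment_eq_image_lineMap] at hz
  obtain ⟨t, ⟨ht0, ht1⟩, rfl⟩ := hz
  have hre : (AffineMap.lineMap (toC P) (toC Q) t : ℂ).re = P.1 + t * (Q.1 - P.1) := by
    simp [AffineMap.lineMap_apply_module']; ring
  have him : (AffineMap.lineMap (toC P) (toC Q) t : ℂ).im = P.2 + t * (Q.2 - P.2) := by
    simp [AffineMap.lineMap_apply_module']; ring
  rw [hre, him]
  rcases (adj_iff P Q).1 h with ⟨h1, h2⟩ | ⟨h1, h2⟩ | ⟨h1, h2⟩ | ⟨h1, h2⟩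
  · left
    rw [h1, h2]; push_cast
    refine ⟨by ring, by ring, ?_, ?_⟩
    · rw [min_eq_left (by linarith)]; nlinarith
    · rw [max_eq_right (by linarith)]; nlinarith
  · right
    rw [h1, h2]; push_cast
    refine ⟨by ring, by ring, ?_, ?_⟩
    · rw [min_eq_left (by linarith)]; nlinarith
    · rw [max_eq_right (by linarith)]; nlinarith
  · left
    rw [h1, h2]; push_cast
    refine ⟨by ring, by ring, ?_, ?_⟩
    · rw [min_eq_right (by linarith)]; nlinarith
    · rw [max_eq_left (by linarith)]; nlinarith
  · right
    rw [h1, h2]; push_cast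
    refine ⟨by ring, by ring, ?_, ?_⟩
    · rw [min_eq_right (by linarith)]; nlinarith
    · rw [max_eq_left (by linarith)]; nlinarith

/-- A face centre lies on no unit lattice segment. [folklore] -/
theorem ctr_notMem_segment_toC {P Q : ℤ × ℤ} (h : RectLoop.Adj P Q) (f : ℤ × ℤ) :
    ctr f ∉ segment ℝ (toC P) (toC Q) := by
  intro hz
  rcases segment_toC_subset h hz with ⟨h1, -, -, -⟩ | ⟨h1, -, -, -⟩
  · exact int_add_half_ne_int f.2 P.2 (by simpa using h1)
  · exact int_add_half_ne_int f.1 P.1 (by simpa using h1)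

namespace ClosedWalk

variable {n : ℕ} (c : ClosedWalk n)

/-! ### The polygon of the walk -/

/-- The polygonal path through `v 0, v 1, …, v m`. [folklore] -/
def polygon : (m : ℕ) → Path (toC (c.v 0)) (toC (c.v m))
  | 0 => Path.refl _
  | m + 1 => (polygon m).trans (Path.segment (toC (c.v m)) (toC (c.v (m + 1))))

/-- **The closed polygon of the walk**, a loop in `ℂ` based at `v 0`. [folklore] -/
def loop : Path (toC (c.v 0)) (toC (c.v 0)) := (c.polygon n).cast rfl (by rw [c.v_n])

/-- The polygon runs along the step segments. [folklore] -/
theorem range_polygon_subset (m : ℕ) :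
    Set.range (c.polygon m) ⊆
      {toC (c.v 0)} ∪ ⋃ j ∈ Finset.range m, segment ℝ (toC (c.v j)) (toC (c.v (j + 1))) := by
  induction m with
  | zero =>
    intro z hz
    simp only [polygon, Path.refl_range, Set.mem_singleton_iff] at hz
    exact Or.inl hz
  | succ m ih =>
    intro z hz
    simp only [polygon, Path.trans_range, Set.mem_union, Path.range_segment] at hz
    rcases hz with hz | hz
    · rcases ih hz with h | h
      · exact Or.inl h
      · refine Or.inr ?_
        simp only [Set.mem_iUnion, Finset.mem_range, exists_prop] at h ⊢
        obtain ⟨j, hj, hjz⟩ := h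
        exact ⟨j, by omega, hjz⟩
    · refine Or.inr ?_
      simp only [Set.mem_iUnion, Finset.mem_range, exists_prop]
      exact ⟨m, by omega, hz⟩

/-- The loop runs along the step segments. [folklore] -/
theorem range_loop_subset (hn : 0 < n) :
    Set.range (c.loop) ⊆ ⋃ j ∈ Finset.range n, segment ℝ (toC (c.v j)) (toC (c.v (j + 1))) := by
  intro z hz
  have hz' : z ∈ Set.range (c.polygon n) := by
    obtain ⟨t, rfl⟩ := hz
    exact ⟨t, rfl⟩
  rcases c.range_polygon_subset n hz' with h | h
  · rw [Set.mem_singleton_iff] at h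
    subst h
    simp only [Set.mem_iUnion, Finset.mem_range, exists_prop]
    exact ⟨0, hn, left_mem_segment _ _ _⟩
  · exact h

/-- A face centre is not a lattice point. [folklore] -/
theorem ctr_ne_toC (f P : ℤ × ℤ) : ctr f ≠ toC P := fun h =>
  int_add_half_ne_int f.1 P.1 (by simpa using congrArg Complex.re h)

/-- A face centre is not on the polygon. [folklore] -/
theorem ctr_notMem_range_polygon (m : ℕ) (f : ℤ × ℤ) : ctr f ∉ Set.range (c.polygon m) := by
  intro h
  rcases c.range_polygon_subset m h with h' | h'
  · exact ctr_ne_toC f _ (Set.mem_singleton_iff.1 h')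
  · simp only [Set.mem_iUnion, Finset.mem_range, exists_prop] at h'
    obtain ⟨j, -, hj⟩ := h'
    exact ctr_notMem_segment_toC (c.adj j) f hj

/-- A face centre is not on the loop. [folklore] -/
theorem ctr_notMem_range_loop (f : ℤ × ℤ) : ctr f ∉ Set.range (c.loop) := by
  intro h
  apply c.ctr_notMem_range_polygon n f
  obtain ⟨t, ht⟩ := h
  exact ⟨t, ht⟩

/-- Casting the endpoints of a path does not change its crossing defects (a private copy of
`Path.crossInc_cast` of `MedialCycleSeparation.lean`, not imported here). [folklore] -/
private theorem crossInc_cast_eq {a b a' b' : ℂ} (γ : Path a b) (ha : a' = a) (hb : b' = b)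
    (ℓ r : ℂ) : (γ.cast ha hb).crossInc ℓ r = γ.crossInc ℓ r := by
  subst ha hb
  rfl

/-! ### Crossing counts of the polygon relative to a pair of horizontally adjacent face centres -/

/-- The crossing defect of the polygon is the sum of those of its unit segments. [folklore] -/
theorem crossInc_polygon (m : ℕ) (f g : ℤ × ℤ) :
    (c.polygon m).crossInc (ctr f) (ctr g) =
      ∑ j ∈ Finset.range m, (Path.segment (toC (c.v j)) (toC (c.v (j + 1)))).crossInc (ctr f) (ctr g) := by
  induction m with
  | zero => simp [polygon, Path.crossInc_refl]
  | succ m ih =>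
    rw [Finset.sum_range_succ, ← ih]
    simp only [polygon]
    have hs : ∀ f : ℤ × ℤ, ctr f ∉ Set.range (Path.segment (toC (c.v m)) (toC (c.v (m + 1)))) :=
      fun f => by rw [Path.range_segment]; exact ctr_notMem_segment_toC (c.adj m) f
    exact Path.crossInc_trans _ _ (c.ctr_notMem_range_polygon m f) (hs f)
      (c.ctr_notMem_range_polygon m g) (hs g)

/-- **The crossing defect of one unit segment** relative to the horizontal segment joining the
centres of the faces `(p - 1, q)` and `(p, q)` (which crosses the vertical edge
`(p, q) — (p, q + 1)` at its midpoint): `2πi` for the step up that edge, `-2πi` for the step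
down, `0` for every other step. [folklore] -/
theorem crossInc_segment_step (j : ℕ) (p q : ℤ) :
    (Path.segment (toC (c.v j)) (toC (c.v (j + 1)))).crossInc (ctr (p - 1, q)) (ctr (p, q)) =
      (indZ (c.v j = (p, q) ∧ c.v (j + 1) = (p, q + 1)) -
        indZ (c.v j = (p, q + 1) ∧ c.v (j + 1) = (p, q))) * (2 * π * I) := by
  -- the side functional of the two endpoints of the vertical edge
  have hside : ∀ P : ℤ × ℤ, segSide (ctr (p - 1, q)) (ctr (p, q)) (toC P) =
      ((P.2 : ℝ) - q - 1 / 2) * (-1) := by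
    intro P
    simp only [segSide, Complex.mul_im, Complex.sub_re, Complex.sub_im, Complex.conj_re,
      Complex.conj_im, toC_re, toC_im, ctr_re, ctr_im, Int.cast_sub, Int.cast_one]
    ring
  have hmid : ∀ P Q : ℤ × ℤ, P.1 = p → Q.1 = p → P.2 + Q.2 = 2 * q + 1 →
      ∃ x ∈ segment ℝ (toC P) (toC Q), x ∈ openSegment ℝ (ctr (p - 1, q)) (ctr (p, q)) := by
    intro P Q hP hQ hPQ
    refine ⟨midpoint ℝ (toC P) (toC Q), midpoint_mem_segment _ _, ?_⟩
    have hPQ' : (P.2 : ℝ) + Q.2 = 2 * q + 1 := by exact_mod_cast hPQ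
    have hm : midpoint ℝ (toC P) (toC Q) = midpoint ℝ (ctr (p - 1, q)) (ctr (p, q)) := by
      apply Complex.ext
      · simp only [midpoint_eq_smul_add, invOf_eq_inv, Complex.smul_re, Complex.add_re, toC_re,
          ctr_re, hP, hQ, smul_eq_mul, Int.cast_sub, Int.cast_one]
        ring
      · simp only [midpoint_eq_smul_add, invOf_eq_inv, Complex.smul_im, Complex.add_im, toC_im,
          ctr_im, smul_eq_mul]
        linarith
    rw [hm]
    refine mem_openSegment_of_ne_left_right ?_ ?_ (midpoint_mem_segment _ _)
    · intro h
      have := congrArg Complex.re h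
      simp only [midpoint_eq_smul_add, invOf_eq_inv, Complex.smul_re, Complex.add_re, ctr_re,
        smul_eq_mul, Int.cast_sub, Int.cast_one] at this
      linarith
    · intro h
      have := congrArg Complex.re h
      simp only [midpoint_eq_smul_add, invOf_eq_inv, Complex.smul_re, Complex.add_re, ctr_re,
        smul_eq_mul, Int.cast_sub, Int.cast_one] at this
      linarith
  by_cases hup : c.v j = (p, q) ∧ c.v (j + 1) = (p, q + 1)
  · -- the step up the edge: from the positive to the negative side
    have hdn : ¬ (c.v j = (p, q + 1) ∧ c.v (j + 1) = (p, q)) := fun h => by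
      have := hup.1.symm.trans h.1; simp at this
    rw [indZ_of_pos hup, indZ_of_neg hdn]
    norm_num
    refine Path.crossInc_segment_of_cross ?_ ?_ (hmid _ _ (by rw [hup.1]) (by rw [hup.2])
      (by rw [hup.1, hup.2]; ring))
    · rw [hside, hup.1]; push_cast; linarith
    · rw [hside, hup.2]; push_cast; linarith
  by_cases hdn : c.v j = (p, q + 1) ∧ c.v (j + 1) = (p, q)
  · -- the step down the edge
    rw [indZ_of_neg hup, indZ_of_pos hdn]
    norm_num
    refine Path.crossInc_segment_of_cross' ?_ ?_ (hmid _ _ (by rw [hdn.1]) (by rw [hdn.2])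
      (by rw [hdn.1, hdn.2]; ring))
    · rw [hside, hdn.1]; push_cast; linarith
    · rw [hside, hdn.2]; push_cast; linarith
  -- every other step misses the segment between the two centres
  rw [indZ_of_neg hup, indZ_of_neg hdn]
  norm_num
  refine Path.crossInc_eq_zero _ fun t ht => ?_
  have hz : (Path.segment (toC (c.v j)) (toC (c.v (j + 1)))) t ∈
      segment ℝ (toC (c.v j)) (toC (c.v (j + 1))) := by
    rw [← Path.range_segment]; exact ⟨t, rfl⟩
  set z := (Path.segment (toC (c.v j)) (toC (c.v (j + 1)))) t with hzdef
  -- points of the segment between the centres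
  rw [segment_eq_image_lineMap] at ht
  obtain ⟨s, ⟨hs0, hs1⟩, hsz⟩ := ht
  have hzre : z.re = p - 1 / 2 + s := by
    rw [← hsz]; simp [AffineMap.lineMap_apply_module']; ring
  have hzim : z.im = q + 1 / 2 := by
    rw [← hsz]; simp [AffineMap.lineMap_apply_module']
  rcases segment_toC_subset (c.adj j) hz with ⟨h1, -, -, -⟩ | ⟨h1, h2, h3, h4⟩
  · exact int_add_half_ne_int q (c.v j).2 (by rw [← hzim, h1])
  · -- a vertical step in the column `p`, between the rows `q` and `q + 1`: it is the edge
    have ha : (c.v j).1 = p := by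
      have e1 : ((c.v j).1 : ℝ) = p - 1 / 2 + s := by rw [← h1, hzre]
      have e2 : (p : ℝ) - 1 < (c.v j).1 := by linarith
      have e3 : ((c.v j).1 : ℝ) < p + 1 := by linarith
      have e2' : p - 1 < (c.v j).1 := by exact_mod_cast e2
      have e3' : (c.v j).1 < p + 1 := by exact_mod_cast e3
      omega
    have ha' : (c.v (j + 1)).1 = p := by
      have h12 : (c.v (j + 1)).1 = (c.v j).1 := by exact_mod_cast h2.symm.trans h1
      omega
    rw [hzim] at h3 h4
    rcases c.step j with ⟨e1, e⟩ | ⟨-, e⟩ | ⟨e1, e⟩ | ⟨-, e⟩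
    · exact absurd ha' (by omega)
    · rw [e] at h3 h4
      push_cast at h3 h4
      rw [min_eq_left (by linarith), ] at h3
      rw [max_eq_right (by linarith)] at h4
      have hb : (c.v j).2 = q := by
        have e2 : ((c.v j).2 : ℝ) < q + 1 := by linarith
        have e3 : (q : ℝ) < (c.v j).2 + 1 := by linarith
        have e2' : (c.v j).2 < q + 1 := by exact_mod_cast e2
        have e3' : q < (c.v j).2 + 1 := by exact_mod_cast e3
        omega
      exact hup ⟨Prod.ext ha hb, Prod.ext ha' (by rw [e, hb])⟩
    · exact absurd ha' (by omega)
    · rw [e] at h3 h4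
      push_cast at h3 h4
      rw [min_eq_right (by linarith)] at h3
      rw [max_eq_left (by linarith)] at h4
      have hb : (c.v j).2 = q + 1 := by
        have e2 : ((c.v j).2 : ℝ) < q + 2 := by linarith
        have e3 : (q : ℝ) < (c.v j).2 := by linarith
        have e2' : (c.v j).2 < q + 2 := by exact_mod_cast e2
        have e3' : q < (c.v j).2 := by exact_mod_cast e3
        omega
      exact hdn ⟨Prod.ext ha hb, Prod.ext ha' (by rw [e, hb]; ring)⟩

/-- The crossing defect of the whole polygon relative to two horizontally adjacent face centres
is `2πi` times the net flux through the edge between them. [folklore] -/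
theorem crossInc_loop_eq (p q : ℤ) :
    (c.loop).crossInc (ctr (p - 1, q)) (ctr (p, q)) = c.cV p q * (2 * π * I) := by
  have hcast : (c.loop).crossInc (ctr (p - 1, q)) (ctr (p, q)) =
      (c.polygon n).crossInc (ctr (p - 1, q)) (ctr (p, q)) := crossInc_cast_eq _ _ _ _ _
  rw [hcast, crossInc_polygon, cV_eq_cnt]
  unfold cnt
  simp only [crossInc_segment_step, ← Finset.sum_mul]
  push_cast
  rw [Finset.sum_sub_distrib]

/-! ### The winding number of the loop about a face centre is the combinatorial winding number -/

/-- Far to the left the loop has winding number zero (it stays in a half-plane avoiding the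
point, where `z - centre` has a principal logarithm). [folklore] -/
theorem wind_loop_sub_ctr_eq_zero_of_lt (hn : 0 < n) {p q : ℤ} (hp : ∀ j, p < (c.v j).1) :
    wind (fun t => c.loop.extend t - ctr (p, q)) = 0 := by
  have hpi : (2 * π * Complex.I : ℂ) ≠ 0 :=
    mul_ne_zero (mul_ne_zero two_ne_zero (by exact_mod_cast Real.pi_ne_zero)) Complex.I_ne_zero
  have hre : ∀ t, (p : ℝ) + 1 / 2 < (c.loop.extend t).re := by
    intro t
    have hmem : c.loop.extend t ∈ Set.range c.loop := by
      rw [Path.extend]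
      exact ⟨_, rfl⟩
    have h' := c.range_loop_subset hn hmem
    simp only [Set.mem_iUnion, Finset.mem_range, exists_prop] at h'
    obtain ⟨j, -, hj⟩ := h'
    have hp1 : (p : ℝ) + 1 ≤ (c.v j).1 := by exact_mod_cast hp j
    have hp2 : (p : ℝ) + 1 ≤ (c.v (j + 1)).1 := by exact_mod_cast hp (j + 1)
    rcases segment_toC_subset (c.adj j) hj with ⟨-, -, h3, -⟩ | ⟨h1, -, -, -⟩
    · have : (p : ℝ) + 1 ≤ min ((c.v j).1 : ℝ) (c.v (j + 1)).1 := le_min hp1 hp2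
      linarith
    · linarith
  have hloop : IsNonvanishingLoop fun t => c.loop.extend t - ctr (p, q) := by
    refine ⟨(c.loop.continuous_extend.sub continuous_const).continuousOn, fun t _ h => ?_, ?_⟩
    · have := hre t
      rw [sub_eq_zero.1 h, ctr_re] at this
      simp at this
    · simp
  have h1 := logInc_eq_wind_mul hloop
  rw [logInc_eq_log_sub_log hloop.continuousOn fun t _ => ?_] at h1
  · simp only [Path.extend_one, Path.extend_zero, sub_self] at h1
    have h2 : ((wind fun t => c.loop.extend t - ctr (p, q)) : ℂ) = 0 :=
      (mul_eq_zero.1 h1.symm).resolve_right hpi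
    exact_mod_cast h2
  · rw [Complex.mem_slitPlane_iff]
    left
    have := hre t
    simp only [Complex.sub_re, ctr_re] at this ⊢
    linarith

/-- **The winding number of the closed polygon of a lattice walk about the centre of a face is
the combinatorial winding number of that face.** [folklore] -/
theorem wind_loop_sub_ctr (hn : 0 < n) (f : ℤ × ℤ) :
    wind (fun t => c.loop.extend t - ctr f) = c.W f := by
  -- a column to the left of the walk
  obtain ⟨P, hP⟩ : ∃ P : ℤ, ∀ j, P < (c.v j).1 := by
    have hne : (Finset.range n).Nonempty := Finset.nonempty_range_iff.2 hn.ne'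
    refine ⟨((Finset.range n).image fun j => (c.v j).1).min' (hne.image _) - 1, fun j => ?_⟩
    have : (c.v j).1 ∈ (Finset.range n).image fun j => (c.v j).1 :=
      Finset.mem_image.2 ⟨j % n, Finset.mem_range.2 (Nat.mod_lt _ hn), by rw [c.v_mod]⟩
    have := Finset.min'_le _ _ this
    linarith
  obtain ⟨p, q⟩ := f
  -- induction along the row `q`, starting from the column `P`
  have key : ∀ m : ℕ, wind (fun t => c.loop.extend t - ctr (P + m, q)) = c.W (P + m, q) := by
    intro m
    induction m with
    | zero =>
      simp only [Nat.cast_zero, add_zero]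
      rw [c.wind_loop_sub_ctr_eq_zero_of_lt hn hP, c.W_eq_zero_of_lt_fst hP]
    | succ m ih =>
      have hpi : (2 * π * Complex.I : ℂ) ≠ 0 :=
        mul_ne_zero (mul_ne_zero two_ne_zero (by exact_mod_cast Real.pi_ne_zero)) Complex.I_ne_zero
      have hjump := c.crossInc_loop_eq (P + m + 1) q
      rw [Path.crossInc_loop _ (c.ctr_notMem_range_loop _) (c.ctr_notMem_range_loop _),
        add_sub_cancel_right] at hjump
      have hjump' : wind (fun t => c.loop.extend t - ctr (P + m, q)) -
          wind (fun t => c.loop.extend t - ctr (P + m + 1, q)) = c.cV (P + m + 1) q := by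
        exact_mod_cast mul_right_cancel₀ hpi hjump
      push_cast
      rw [← add_assoc, c.W_succ_fst, ← ih]
      linarith
  by_cases hpP : P ≤ p
  · obtain ⟨m, rfl⟩ : ∃ m : ℕ, p = P + m := ⟨(p - P).toNat, by omega⟩
    exact key m
  · have hp : ∀ j, p < (c.v j).1 := fun j => (not_le.1 hpP).trans (hP j)
    rw [c.wind_loop_sub_ctr_eq_zero_of_lt hn hp, c.W_eq_zero_of_lt_fst hp]

/-! ### Inside a simply connected set the loop encloses no point of the complement -/

/-- **A closed lattice walk inside a simply connected plane set `K` has winding number zero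
about every face centre outside `K`.** In particular, when `K` is a union of closed lattice
faces, every face with non-zero winding number belongs to `K` (a simply connected union of
squares has no holes). [folklore] -/
theorem W_eq_zero_of_ctr_notMem (hn : 0 < n) {K : Set ℂ} (hK : IsSimplyConnected K)
    (hsub : ∀ j, segment ℝ (toC (c.v j)) (toC (c.v (j + 1))) ⊆ K) {f : ℤ × ℤ} (hf : ctr f ∉ K) :
    c.W f = 0 := by
  have hloopK : ∀ t, c.loop t ∈ K := by
    intro t
    have h := c.range_loop_subset hn ⟨t, rfl⟩
    simp only [Set.mem_iUnion, Finset.mem_range, exists_prop] at h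
    obtain ⟨j, -, hj⟩ := h
    exact hsub j hj
  obtain ⟨F, hF⟩ := (isSimplyConnected_iff_exists_homotopy_refl_forall_mem.1 hK).2 _ c.loop hloopK
  -- the homotopy, read on `ℝ × ℝ` and translated by the centre
  set H : ℝ → ℝ → ℂ := fun s t =>
    F (Set.projIcc 0 1 zero_le_one s, Set.projIcc 0 1 zero_le_one t) - ctr f with hH
  have hcont : ContinuousOn (Function.uncurry H) (Set.Icc 0 1 ×ˢ Set.Icc 0 1) := by
    apply Continuous.continuousOn
    have : Continuous fun x : ℝ × ℝ =>
        (Set.projIcc (0 : ℝ) 1 zero_le_one x.1, Set.projIcc (0 : ℝ) 1 zero_le_one x.2) := by fun_prop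
    exact (F.continuous.comp this).sub continuous_const
  have hne : ∀ s ∈ Set.Icc (0 : ℝ) 1, ∀ t ∈ Set.Icc (0 : ℝ) 1, H s t ≠ 0 := by
    intro s _ t _ h
    apply hf
    rw [← sub_eq_zero.1 h]
    exact hF _
  have hends : ∀ s ∈ Set.Icc (0 : ℝ) 1, H s 0 = H s 1 := by
    intro s _
    simp only [hH, Set.projIcc_left, Set.projIcc_right]
    rw [show ((⟨0, Set.left_mem_Icc.2 zero_le_one⟩ : Set.Icc (0 : ℝ) 1)) = (0 : unitInterval) from rfl,
      show ((⟨1, Set.right_mem_Icc.2 zero_le_one⟩ : Set.Icc (0 : ℝ) 1)) = (1 : unitInterval) from rfl,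
      F.source, F.target]
  have h1 : ∀ t, H 1 t = toC (c.v 0) - ctr f := by
    intro t
    simp only [hH, Set.projIcc_right]
    rw [show ((⟨1, Set.right_mem_Icc.2 zero_le_one⟩ : Set.Icc (0 : ℝ) 1)) = (1 : unitInterval) from rfl,
      F.apply_one, Path.coe_toContinuousMap, Path.refl_apply]
  have h0 := wind_eq_zero_of_homotopy_const hcont hends hne h1
  have hH0 : H 0 = fun t => c.loop.extend t - ctr f := by
    funext t
    simp only [hH, Set.projIcc_left]
    rw [show ((⟨0, Set.left_mem_Icc.2 zero_le_one⟩ : Set.Icc (0 : ℝ) 1)) = (0 : unitInterval) from rfl,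
      F.apply_zero, Path.coe_toContinuousMap]
    rfl
  rw [← c.wind_loop_sub_ctr hn f, ← hH0, h0]

end ClosedWalk

end Literature.Probability.LatticeModels

end
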